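import Literature.AlgebraicGeometry.Frobenioids.RealificationMapInjectiveFiniteSupp
import Literature.AlgebraicGeometry.Frobenioids.DirectSumRealification
import Literature.AlgebraicGeometry.Frobenioids.ArithmeticDivisorsPerfFactorial
import Literature.AlgebraicGeometry.Frobenioids.FactorizationTransport
import HarnessLib

/-!
# Frobenioids I, Prop. 5.3 sub-DAG: the row P53/L02a′ (`RlfMapInjective'`) AT THE DATA — direct sums of
# monoprime monoids and arithmetic divisor monoids are finitely supported, so `f^rlf` is injective there

Mochizuki, *The geometry of Frobenioids I*, Kyushu J. Math. **62** (2008), Def. 2.4 (i) p. 48, Prop. 5.3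
p. 103 ("the divisor monoid `Φ^rlf`"), Ex. 6.3 p. 113 (arithmetic divisors `Φ(L) ≅ ⊕_v Λ_v`)
[cite: MochizukiFrdI2008, Prop. 5.3 p.103] [cite: MochizukiFrdI2008, Ex. 6.3 p.113].

Finding P53-F2 (seat abc-iut-w4-d084): the slot `FrdI.Prop53Sub.RlfMapInjective'` is undecidable as typed
(`RealificationMapInjectiveIndependence.lean`) but holds for FINITELY SUPPORTED divisor monoids
(`RealificationMapInjectiveFiniteSupp.lean`, `IsPerfFactorial.Rlf.map_injective_of_disjoint_supp_of_finite`).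
This file discharges the finiteness hypothesis AT THE DATA of the cell (L1-lead R105a (3): "consumable at the
data"): (i) finiteness of supports is invariant under isomorphisms of monoids (`FactorizationTransport`);
(ii) every `b ∈ (⊕_i M_i)^pf` is finitely supported (`DirectSum.supp_factorMap_finite`, seat abc-iut-L1-d2),
hence the slot holds for every DIRECT SUM of monoprime monoids; (iii) hence for the arithmetic divisor monoids
`Φ(L)` of Ex. 6.3 (`Φ(L) ≅ ⊕_v Λ_v`, `EffArithDivisor.effArithDivisorEquiv`).  Proof-only.
Seat abc-iut-w4-d084 (cell abc-iut; GAP-LEDGER G-w4d084-1 / FLAG P53-F2).  Nothing here bears on [IUTchIII]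
Cor. 3.12.
-/

noncomputable section

namespace Literature.AlgebraicGeometry.Frobenioids

open Function Literature.AnabelianGeometry.EtaleTheta

universe u v

/-! ### Finiteness of supports transports along isomorphisms -/

/-- **Finitely supported factorizations are preserved by isomorphisms of monoids**: if every element of `M^pf`
has finite support then so does every element of `M'^pf` for `M ≅ M'` (`fmap (e a) = piR e (fmap a)` and
`Supp(piR x) = e(Supp x)`). [cite: MochizukiFrdI2008, Def. 2.4(i) p.47] -/
theorem supp_factorMap_finite_of_mulEquiv {M M' : Type u} [CommMonoid M] [CommMonoid M'] (e : M ≃* M')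
    (hfin : ∀ b : Perfection M, (supp (factorMap M b)).Finite) (b' : Perfection M') :
    (supp (factorMap M' b')).Finite := by
  obtain ⟨b, rfl⟩ := (Perfection.congr e).surjective b'
  have h1 : factorMap M' (Perfection.congr e b) =
      Factorization.piR (Perfection.congr e) (factorMap M b) := Factorization.fmap_congr (Perfection.congr e) b
  rw [h1, supp_eq, Factorization.supp_piR]
  refine (hfin b).preimage (Set.injOn_of_injective ?_)
  intro x y hxy
  have := congrArg (Primes.congr (Perfection.congr e)) hxy
  rwa [Primes.congr_apply_congr_symm, Primes.congr_apply_congr_symm] at this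

/-! ### Direct sums of monoprime monoids -/

namespace DirectSum

variable {ι : Type u} {M : ι → Type v} [∀ i, CommMonoid (M i)] [DecidableEq ι] (hM : ∀ i, IsMonoprime (M i))
include hM

/-- **Row P53/L02a′ AT THE DATA, direct sums**: for `⊕_i M_i` (monoprime `M_i`: the divisor monoids of the
motivating examples), any perf-factorial `N` and a characteristically injective `f : ⊕_i M_i → N` sending
primary elements of distinct primes to elements with disjoint supports in `N^rlf`, the realification `f^rlf` is
INJECTIVE — the finiteness hypothesis of `map_injective_of_disjoint_supp_of_finite` holds by
`DirectSum.supp_factorMap_finite`. [cite: MochizukiFrdI2008, Prop. 5.3 p.103] -/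
theorem rlfMap_injective_of_disjoint_supp {N : Type (max u v)} [CommMonoid N] (hN : IsPerfFactorial N)
    {f : directSum M →* N} (hf : IsCharInjective f)
    (hdisj : ∀ (𝔭 𝔮 : Primes (Perfection (directSum M))), 𝔭 ≠ 𝔮 → ∀ x ∈ 𝔭.carrier, ∀ y ∈ 𝔮.carrier,
      Disjoint (supp (hN.toRealification (Perfection.map f x) : RlfFactor N))
        (supp (hN.toRealification (Perfection.map f y) : RlfFactor N))) :
    Injective (IsPerfFactorial.Rlf.map (isPerfFactorial hM) hN f) :=
  IsPerfFactorial.Rlf.map_injective_of_disjoint_supp_of_finite (isPerfFactorial hM) hN hf hdisj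
    (supp_factorMap_finite hM)

end DirectSum

/-! ### Arithmetic divisor monoids `Φ(L)` (Ex. 6.3) -/

namespace EffArithDivisor

variable (L : Type u) [Field L] [NumberField L]

/-- Every element of `Φ(L)^pf` is finitely supported (`Φ(L) ≅ ⊕_v Λ_v`). [cite: MochizukiFrdI2008, Ex. 6.3 p.113] -/
theorem supp_factorMap_finite (b : Perfection (Multiplicative (EffArithDivisor L))) :
    (supp (factorMap (Multiplicative (EffArithDivisor L)) b)).Finite := by
  classical
  exact supp_factorMap_finite_of_mulEquiv (effArithDivisorEquiv L).symm
    (DirectSum.supp_factorMap_finite (isMonoprime_placeCoeff L)) b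

/-- **Row P53/L02a′ AT THE DATA, arithmetic divisors**: for the divisor monoid `Φ(L)` of the arithmetic
Frobenioids (Ex. 6.3 / Thm. 6.4), every characteristically injective `f : Φ(L) → N` into a perf-factorial
monoid sending primaries of distinct primes to elements with disjoint supports has an injective
realification `f^rlf` (any perf-factoriality witness `hΦ`). [cite: MochizukiFrdI2008, Ex. 6.3 p.113] -/
theorem rlfMap_injective_of_disjoint_supp (hΦ : IsPerfFactorial (Multiplicative (EffArithDivisor L)))
    {N : Type u} [CommMonoid N] (hN : IsPerfFactorial N) {f : Multiplicative (EffArithDivisor L) →* N}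
    (hf : IsCharInjective f)
    (hdisj : ∀ (𝔭 𝔮 : Primes (Perfection (Multiplicative (EffArithDivisor L)))), 𝔭 ≠ 𝔮 →
      ∀ x ∈ 𝔭.carrier, ∀ y ∈ 𝔮.carrier,
        Disjoint (supp (hN.toRealification (Perfection.map f x) : RlfFactor N))
          (supp (hN.toRealification (Perfection.map f y) : RlfFactor N))) :
    Injective (IsPerfFactorial.Rlf.map hΦ hN f) :=
  IsPerfFactorial.Rlf.map_injective_of_disjoint_supp_of_finite hΦ hN hf hdisj (supp_factorMap_finite L)

end EffArithDivisor

end Literature.AlgebraicGeometry.Frobenioids
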